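import Summits.HodgeConjecture.HodgeConjecture.Theorems.Ring2WeilCoverageCMFieldCellsHodgeAtMember
import Literature.NumberTheory.ComplexMultiplication.PrimitiveCMTypeExistenceNonGalois
import HarnessLib

/-!
# Ring 2 — Weil-type family-coverage census, CM-field rows (X-G): NON-GALOIS fields — every δ-cell of ANY CM field
# (given Deligne's presentation) contains the CM member `B^p × (B^ρ)^p`; HC at it for every non-Galois QUARTIC CM field

HONEST FRAMING: research route conditional on HC_CM; not a corollary; Q11.4-sentence-2 already refuted in dim ≥ 3.

Cell `pub-hodge-ring2`, seat `ring2-b03` (gen 55), census `WEIL-FAMILY-COVERAGE.md` «## b03» (the non-Galois `D₄` field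
`ℚ(√-(3+√2))`, b03.5 / b03.13 / b03.18). THEOREMS ONLY: no `def`, no named fact, no `sorry`; `HC_CM` does not occur;
HC is USED only where the tree proves it (`Pohlmann1968.IsNondegenerate.hodgeConjectureFor_pow`). Parts X-A/X-B/X-C
carry `[IsGalois ℚ K]` only because the CorCM lemma `AndreSplit.isWeilTypeCM_diagHom` is stated with that (unused)
binder. Here: `isWeilTypeCM_diagHom'` (the same lemma for ANY CM field); `exists_cmPower_hasWeilDiscriminantCM_anyCM`
(over private Galois-free copies of X-A §1 / X-B §1: on EVERY δ-row of any CM field the power `B^{2p}`, actions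
`ι` / `ι ∘ c`, of CM type and dimension `2p·e₀`, with a Weil-type `η` and a Rosati-compatible polarization class of
discriminant `δ`); `exists_cmMember_hodgeConjectureFor_of_exists_isNondegenerate` (HC at the member for any field with a
nondegenerate type); `exists_cmEightfold_hodgeConjectureFor_of_not_isGalois_four` — **every NON-GALOIS QUARTIC CM field**
(primitive type by Schappacher, `PrimitiveCMTypeNonGalois.exists_isPrimitive_of_not_isGalois`; nondegenerate by Yanai):
on EVERY row a CM eightfold `B⁴` with a Rosati-compatible polarization class of discriminant `δ`, HC (kernel) and
`W_E(B⁴) ⊗ ℂ` algebraic — the census's `D₄` field; with part X-C: EVERY quartic CM field, all SEVEN census fields.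
HONEST COLUMN: no positivity (`IsPolarizationClass`); nothing at any non-CM member; general member OPEN (transport).

## References
* [Deligne1982HodgeCycles] P. Deligne (notes by J. S. Milne), LNM 900 (1982), §4 Prop. 4.4, Lemma 4.6; §5 (b)–(c).
* [Schmidt1984CMArithmetik] C.-G. Schmidt, LNM 1082 (1984), Kap. II Satz 1.6 (Schappacher 1977). [Yanai1985] §4.
* [Pohlmann1968] H. Pohlmann, Ann. of Math. 88 (1968), Thm. 1. [Shimura1998] §5.2 (2), §6.2 Thm. 3.
-/

noncomputable section

set_option linter.dupNamespace false

namespace Summit.HodgeConjecture.HodgeConjecture.Ring2.WeilCoverageCM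

open CategoryTheory CategoryTheory.Limits Polynomial NumberField
open Literature.AlgebraicTopology.SingularHomology
open Literature.AlgebraicGeometry Literature.AlgebraicGeometry.Motives Literature.AlgebraicGeometry.HodgeTheory
open Literature.AlgebraicGeometry.ComplexMultiplication Literature.AlgebraicGeometry.Deligne1982
open Literature.AlgebraicGeometry.Milne1999
open Literature.AlgebraicGeometry.Pohlmann1968 (IsNondegenerate isNondegenerate_of_isPrimitive_of_prime)
open Literature.Geometry.Kaehler (lefschetzPow HasHardLefschetzProperty)
open Literature.AlgebraicGeometry.VanGeemen1994 (pullbackOne)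
open Literature.NumberTheory.Automorphic.PicardCM (eigenline)
open Literature.NumberTheory.ComplexMultiplication (CMTypeOps.bar CMTypeOps.mem_bar_iff CMTypeOps.conjugate_mem_iff_notMem
  PrimitiveCMTypeNonGalois.exists_isPrimitive_of_not_isGalois)
open Summit.HodgeConjecture.CorCM.AndreProductForm Summit.HodgeConjecture.CorCM.Milne2020
open Summit.HodgeConjecture.CorCM.AndreSplit
open Summit.HodgeConjecture.HodgeConjecture.Theorems
open Summit.HodgeConjecture.HodgeConjecture.Ring2.Hypotheses (RosatiCompatible)

/-! ## Weil type, the member on every δ-row, and HC at it — any CM field -/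

section AnyCM

variable (K : Type) [Field K] [NumberField K] [IsCMField K]

omit [IsCMField K] in
open scoped Classical in
/-- **André's constant-sum products are of Weil type on Deligne's carriers — ANY CM field** (the CorCM
`AndreSplit.isWeilTypeCM_diagHom` without its unused `[IsGalois ℚ K]` binder; same proof). [cite: Deligne1982HodgeCycles, §4 Prop. 4.4 and §5 (c) p. 38] -/
theorem isWeilTypeCM_diagHom'
    {d p : ℕ} (hd : d = 2 * p) (hp : 0 < p) (B : Fin d → AbelianVariety ℂ)
    (act : ∀ j, 𝓞 K →+* End (B j)) {θB : ∀ j, K →+* Module.End ℂ (complexBetti (B j).X 1)}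
    {Ψ : Fin d → CMType K} (hB : ∀ j, IsCMTypeRealisation (Ψ j) (B j) (act j) (θB j))
    (hadm : ∀ s : K →+* ℂ, (Finset.univ.filter fun j : Fin d => s ∈ (Ψ j).1).card = p)
    (b₀ : 𝓞 K) (hsep : Function.Injective fun σ : K →+* ℂ => σ (b₀ : K))
    {R : Polynomial ℤ} {e₀ : ℕ} (he : Module.finrank ℚ K = 2 * e₀) (hRm : R.Monic) (hRdeg : R.natDegree = e₀)
    (hR : R.comp (X ^ 2) = minpoly ℤ b₀) (hirr : Irreducible (cmPolyQ R))
    (hroots : ∀ s : ℂ, Polynomial.eval₂ (Int.castRingHom ℂ) s R = 0 → s.im = 0 ∧ s.re < 0) :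
    IsWeilTypeCM (⨁ B) (diagHom K B act b₀) R e₀ p := by
  subst hd
  have hv : ∀ j, ∃ v : Module.Basis (K →+* ℂ) ℂ (complexBetti (B j).X 1), ∀ σ, v σ ∈ eigenline (θB j) σ :=
    fun j => exists_eigenbasis (hB j)
  choose vB hvB using hv
  have hfin : 0 < Module.finrank ℚ K := Module.finrank_pos
  have hdim : Module.finrank ℚ K * (2 * p) = 2 * (⨁ B).dim := by
    rw [two_mul_dim_biproduct B vB, Fintype.card_fin, ← NumberField.Embeddings.card K ℂ, mul_comm]
  refine ⟨by omega, hp, hRm, hRdeg, hirr, hroots, ?_, ?_, ?_⟩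
  · rw [hR]
    exact eval₂_diagHom_minpoly K B act b₀
  · rw [he] at hdim
    have e : 2 * (⨁ B).dim = 2 * (2 * p * e₀) := by rw [← hdim]; ring
    exact Nat.eq_of_mul_eq_mul_left two_pos e
  · intro ρ hρ
    rw [hR] at hρ
    obtain ⟨s, rfl⟩ := exists_embedding_of_root K b₀ hρ
    rw [eigenMultiplicity_diagHom_eq_card K B act hB b₀ hsep s, hadm s]

open scoped Classical in
/-- Part X-A §1 for any CM field (private; proof verbatim with `isWeilTypeCM_diagHom'`). [cite: Deligne1982HodgeCycles, §5 (c) pp. 38–39] -/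
private theorem exists_polarizationClass_hasWeilDiscriminantCM_of_constantSum' (hK : 2 < Module.finrank ℚ K)
    {d p : ℕ} (hd : d = 2 * p) (hp : 0 < p) (B : Fin d → AbelianVariety ℂ)
    (act : ∀ j, 𝓞 K →+* End (B j)) {θB : ∀ j, K →+* Module.End ℂ (complexBetti (B j).X 1)}
    {Ψ : Fin d → CMType K} (hB : ∀ j, IsCMTypeRealisation (Ψ j) (B j) (act j) (θB j))
    (hadm : ∀ s : K →+* ℂ, (Finset.univ.filter fun j : Fin d => s ∈ (Ψ j).1).card = p)
    {b₀ : 𝓞 K} (hb₀ : IsCMField.complexConj K (b₀ : K) = -(b₀ : K))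
    (hsep : Function.Injective fun σ : K →+* ℂ => σ (b₀ : K))
    {R : Polynomial ℤ} {e₀ : ℕ} (he : Module.finrank ℚ K = 2 * e₀) (hRm : R.Monic) (hRdeg : R.natDegree = e₀)
    (hR : R.comp (X ^ 2) = minpoly ℤ b₀) (hirr : Irreducible (cmPolyQ R))
    (hroots : ∀ s : ℂ, Polynomial.eval₂ (Int.castRingHom ℂ) s R = 0 → s.im = 0 ∧ s.re < 0)
    (haev : Polynomial.aeval (b₀ : K) (cmPolyQ R) = 0) (hdegQ : (cmPolyQ R).natDegree = Module.finrank ℚ K)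
    [Fact (Irreducible (realPolyQ R))] (δ : cmNormResidueGroup R) :
    IsWeilTypeCM (⨁ B) (diagHom K B act b₀) R e₀ p ∧
      ∃ h : complexBetti (⨁ B).X 2, IsPolarizationClass (⨁ B).dim (⨁ B).X h ∧
        RosatiCompatible (⨁ B) (diagHom K B act b₀) h ∧ HasWeilDiscriminantCM (⨁ B) (diagHom K B act b₀) R e₀ p h δ := by
  obtain ⟨n, rfl⟩ : ∃ n, d = n + 1 := ⟨d - 1, by omega⟩
  have hW : IsWeilTypeCM (⨁ B) (diagHom K B act b₀) R e₀ p :=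
    isWeilTypeCM_diagHom' K hd hp B act hB hadm b₀ hsep he hRm hRdeg hR hirr hroots
  haveI hfE : Fact (Irreducible (cmPolyQ R)) := ⟨hirr⟩
  refine ⟨hW, ?_⟩
  have hv : ∀ j, ∃ v : Module.Basis (K →+* ℂ) ℂ (complexBetti (B j).X 1), ∀ σ, v σ ∈ eigenline (θB j) σ :=
    fun j => exists_eigenbasis (hB j)
  choose b hbmem using hv
  have hb : ∀ a (c : 𝓞 K) (σ : K →+* ℂ),
      complexBetti.map (act a c : B a ⟶ B a).hom.hom.hom 1 (b a σ) = σ (c : K) • b a σ :=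
    fun a c σ => map_ι_apply_of_mem_eigenline (hB a) (hbmem a σ) c
  have htype : ∀ a σ, σ ∈ (Ψ a).1 → IsOfHodgeType (B a).dim (B a).X 1 1 0 (b a σ) :=
    fun a σ hσ => isOfHodgeType_oneZero_of_mem (hB a) (hbmem a σ) hσ
  have hdimB : ∀ a, (B a).dim = e₀ := fun a => by
    rw [dim_eq_of_isCMTypeRealisation (hB a), he, Nat.mul_div_cancel_left _ two_pos]
  have he2 : 2 ≤ e₀ := by omega
  have hdim2 : ∀ a, 2 ≤ (B a).dim := fun a => by rw [hdimB a]; exact he2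
  have hdim0 : ∀ a, 0 < (B a).dim := fun a => by have := hdim2 a; omega
  have h2 : 2 ≤ (cmPolyQ R).natDegree := by rw [hdegQ]; omega
  have hslot := fun a => exists_rosatiClass_hermitianCoeff (hdim2 a) (hb a) (Ψ a) (htype a)
  choose h x ζ hQ halg hKm htop hkill hros hxQ hx0 hcomp hζ hcoef htr hsign using hslot
  have hζ0 : ∀ a, ζ a ≠ 0 := by
    intro a h0
    obtain ⟨σ⟩ : Nonempty (K →+* ℂ) := inferInstance
    have hno : ∀ τ : K →+* ℂ, τ ∉ (Ψ a).1 := by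
      intro τ hτ
      rcases hsign a with hs | hs
      · have h1 := (hs τ).1 hτ
        rw [h0, map_zero, Complex.zero_im] at h1
        exact lt_irrefl _ h1
      · have h1 := (hs τ).1 hτ
        rw [h0, map_zero, Complex.zero_im] at h1
        exact lt_irrefl _ h1
    exact hno σ (((Ψ a).2 σ).mpr (hno _))
  have hHL : ∀ a, HasHardLefschetzProperty (h a) (B a).dim := fun a => by
    obtain ⟨s, hs, hsK⟩ := hKm a
    have h1 := HasHardLefschetzProperty.smul
      (hsK.hasHardLefschetzProperty (AbelianVariety.isSmoothProjective_holds (A := B a))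
        fun _ => Motives.hasHardLefschetzProperty_kaehlerClass_holds)
      (inv_ne_zero (Complex.ofReal_ne_zero.2 hs))
    rwa [smul_smul, inv_mul_cancel₀ (Complex.ofReal_ne_zero.2 hs), one_smul] at h1
  have hpol : ∀ a, IsPolarizationClass (B a).dim (B a).X (h a) := fun a => ⟨hQ a, halg a, hHL a⟩
  have htop' : ∀ a, lefschetzPow (h a) ((B a).dim - 1) 2 (h a) ≠ 0 := fun a => by
    obtain ⟨s, -, hsK⟩ := hKm a
    exact lefschetzPow_self_ne_zero_of_isKaehlerClass_smul (hdim0 a) hsK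
  obtain ⟨κ, hκ⟩ := exists_algEquiv_cmField R haev hdegQ
  obtain ⟨F, hF⟩ := exists_units_realToCM_eq R κ hκ hb₀ hsep h2 ζ hζ hζ0
  obtain ⟨f, hf, hf0, hfprop⟩ := exists_ringOfIntegers_real_prod_eq R κ hκ hb₀ F (0 : Fin (n + 1)) δ
  have hA0 : (B 0).dim = ((B 0).dim - 1) + 1 := by have := hdim0 0; omega
  set T : complexBetti (B 0).X 2 :=
    complexBetti.map (𝟙 (B 0) + (show B 0 ⟶ B 0 from act 0 f)).hom.hom.hom 2 (h 0) - h 0 -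
      complexBetti.map (show B 0 ⟶ B 0 from act 0 f).hom.hom.hom 2 (h 0) with hTdef
  set h' : ∀ a, complexBetti (B a).X 2 := Function.update h 0 T with hh'def
  set ζ' : Fin (n + 1) → K := Function.update ζ 0 (ζ 0 / (2 * (f : K))) with hζ'def
  have hh'0 : h' 0 = T := by rw [hh'def, Function.update_self]
  have hh'a : ∀ a, a ≠ 0 → h' a = h a := fun a ha => by rw [hh'def, Function.update_of_ne ha]
  have hζ'0 : ζ' 0 = ζ 0 / (2 * (f : K)) := by rw [hζ'def, Function.update_self]
  have hζ'a : ∀ a, a ≠ 0 → ζ' a = ζ a := fun a ha => by rw [hζ'def, Function.update_of_ne ha]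
  have hpolT : IsPolarizationClass (B 0).dim (B 0).X T :=
    isPolarizationClass_realTwist (τ := fun σ : K →+* ℂ => σ) (hb 0) (Ψ 0) hf hf0 (hkill 0) (hQ 0) (halg 0)
      (hHL 0)
  have hrosT : ∀ (c cc : 𝓞 K), (cc : K) = IsCMField.complexConj K (c : K) → ∀ y z : complexBetti (B 0).X 1,
      polarizationPairingOne (B 0).X T ((B 0).dim - 1) (complexBetti.map (act 0 c : B 0 ⟶ B 0).hom.hom.hom 1 y) z =
        polarizationPairingOne (B 0).X T ((B 0).dim - 1) y
          (complexBetti.map (act 0 cc : B 0 ⟶ B 0).hom.hom.hom 1 z) :=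
    fun c cc hcc y z => realTwist_rosati (τ := fun σ : K →+* ℂ => σ) (hdim0 0) (hb 0) f (hkill 0) c cc hcc y z
  obtain ⟨dT, hdT0, -, htopT, -⟩ :=
    exists_scalar_realTwist_self hA0 (hb 0) (Ψ 0) hf hf0 (hkill 0) (hros 0)
  have hcoefT : ∀ σ : K →+* ℂ, polarizationPairingOne (B 0).X T ((B 0).dim - 1) ((b 0).coord σ (x 0) • b 0 σ)
      ((b 0).coord (ComplexEmbedding.conjugate σ) (x 0) • b 0 (ComplexEmbedding.conjugate σ)) =
      σ (ζ 0 / (2 * (f : K))) • lefschetzPow T ((B 0).dim - 1) 2 T :=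
    fun σ => realTwist_eigenCoeff hA0 (hb 0) (Ψ 0) hf hf0 (hkill 0) (hros 0) (hcoef 0) σ
  have hpol' : ∀ a, IsPolarizationClass (B a).dim (B a).X (h' a) := by
    intro a
    by_cases ha : a = 0
    · subst ha; rw [hh'0]; exact hpolT
    · rw [hh'a a ha]; exact hpol a
  have hQ' : ∀ a, IsRationalClass (h' a) := fun a => (hpol' a).1
  have htop'' : ∀ a, lefschetzPow (h' a) ((B a).dim - 1) 2 (h' a) ≠ 0 := by
    intro a
    by_cases ha : a = 0
    · subst ha; rw [hh'0, htopT]; exact smul_ne_zero hdT0 (htop' 0)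
    · rw [hh'a a ha]; exact htop' a
  have hros' : ∀ a (c cc : 𝓞 K), (cc : K) = IsCMField.complexConj K (c : K) → ∀ y z : complexBetti (B a).X 1,
      polarizationPairingOne (B a).X (h' a) ((B a).dim - 1)
          (complexBetti.map (act a c : B a ⟶ B a).hom.hom.hom 1 y) z =
        polarizationPairingOne (B a).X (h' a) ((B a).dim - 1) y
          (complexBetti.map (act a cc : B a ⟶ B a).hom.hom.hom 1 z) := by
    intro a
    by_cases ha : a = 0
    · subst ha; rw [hh'0]; exact hrosT
    · rw [hh'a a ha]; exact hros a
  have hζ' : ∀ a, IsCMField.complexConj K (ζ' a) = -ζ' a := by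
    intro a
    by_cases ha : a = 0
    · subst ha; rw [hζ'0]; exact imaginary_div_real (hζ 0) hf
    · rw [hζ'a a ha]; exact hζ a
  have hζ'ne : ∀ a, ζ' a ≠ 0 := by
    intro a
    by_cases ha : a = 0
    · subst ha; rw [hζ'0]; exact div_ne_zero (hζ0 0) (mul_ne_zero two_ne_zero hf0)
    · rw [hζ'a a ha]; exact hζ0 a
  have hcoef' : ∀ a (σ : K →+* ℂ), polarizationPairingOne (B a).X (h' a) ((B a).dim - 1)
      ((b a).coord σ (x a) • b a σ)
      ((b a).coord (ComplexEmbedding.conjugate σ) (x a) • b a (ComplexEmbedding.conjugate σ)) =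
      σ (ζ' a) • lefschetzPow (h' a) ((B a).dim - 1) 2 (h' a) := by
    intro a
    by_cases ha : a = 0
    · subst ha; rw [hh'0, hζ'0]; exact hcoefT
    · rw [hh'a a ha, hζ'a a ha]; exact hcoef a
  obtain ⟨F', hF'⟩ := exists_units_realToCM_eq R κ hκ hb₀ hsep h2 ζ' hζ' hζ'ne
  have hclass : (QuotientGroup.mk (∏ a, F' a) : cmNormResidueGroup R) = δ := by
    refine hfprop F' ?_ fun a ha => ?_
    · rw [hF', hF, ← map_mul, hζ'0]
      congr 1
      field_simp
    · apply Units.ext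
      apply (realToCM R).injective
      rw [hF', hF, hζ'a a ha]
  have hk : n + 1 = 2 * p := hd
  have hdisc := hasWeilDiscriminantCM_sumPolarizationClass R hb hsep κ hκ he hk hQ' htop'' hros' hxQ hx0 hcoef' hF'
  rw [hclass] at hdisc
  exact ⟨sumPolarizationClass B h', isPolarizationClass_sumPolarizationClass B h' hpol',
    polarizationPairingOne_sum_pullbackOne_diag_skew hb hdim0 hros' hb₀, hdisc⟩

/-- `#{j < 2p | j < p} = p` in `Fin (2p)`. [folklore] -/
private theorem card_filter_val_lt_two_mul' (p : ℕ) :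
    ((Finset.univ : Finset (Fin (2 * p))).filter fun j : Fin (2 * p) => (j : ℕ) < p).card = p := by
  refine Finset.card_eq_of_bijective (fun i (hi : i < p) => (⟨i, by omega⟩ : Fin (2 * p))) (fun a ha => ?_)
    (fun i hi => ?_) fun i j hi hj hij => ?_
  · exact ⟨a, (Finset.mem_filter.1 ha).2, rfl⟩
  · exact Finset.mem_filter.2 ⟨Finset.mem_univ _, hi⟩
  · exact Fin.mk.inj_iff.mp hij

/-- `#{j < 2p | ¬ j < p} = p` in `Fin (2p)`. [folklore] -/
private theorem card_filter_not_val_lt_two_mul' (p : ℕ) :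
    ((Finset.univ : Finset (Fin (2 * p))).filter fun j : Fin (2 * p) => ¬ (j : ℕ) < p).card = p := by
  have h := Finset.card_filter_add_card_filter_not (s := (Finset.univ : Finset (Fin (2 * p))))
    (fun j : Fin (2 * p) => (j : ℕ) < p)
  rw [card_filter_val_lt_two_mul', Finset.card_univ, Fintype.card_fin] at h
  omega

open scoped Classical in
/-- Part X-B §1 for any CM field (private; proof verbatim). [cite: Deligne1982HodgeCycles, §5 (b)–(c) pp. 38–39] -/
private theorem exists_cmPower_hasWeilDiscriminantCM' (hK : 2 < Module.finrank ℚ K)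
    {b₀ : 𝓞 K} (hb₀ : IsCMField.complexConj K (b₀ : K) = -(b₀ : K))
    (hsep : Function.Injective fun σ : K →+* ℂ => σ (b₀ : K))
    {R : Polynomial ℤ} {e₀ : ℕ} (he : Module.finrank ℚ K = 2 * e₀) (hRm : R.Monic) (hRdeg : R.natDegree = e₀)
    (hR : R.comp (X ^ 2) = minpoly ℤ b₀) (hirr : Irreducible (cmPolyQ R))
    (hroots : ∀ s : ℂ, Polynomial.eval₂ (Int.castRingHom ℂ) s R = 0 → s.im = 0 ∧ s.re < 0)
    (haev : Polynomial.aeval (b₀ : K) (cmPolyQ R) = 0) (hdegQ : (cmPolyQ R).natDegree = Module.finrank ℚ K)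
    [Fact (Irreducible (realPolyQ R))]
    {Ψ : CMType K} {B : AbelianVariety ℂ} {ι : 𝓞 K →+* End B} {θ : K →+* Module.End ℂ (complexBetti B.X 1)}
    (hB : IsCMTypeRealisation Ψ B ι θ) {p : ℕ} (hp : 0 < p) (δ : cmNormResidueGroup R) :
    ∃ (act : Fin (2 * p) → (𝓞 K →+* End B)) (h : complexBetti (⨁ fun _ : Fin (2 * p) => B).X 2),
      (∀ j : Fin (2 * p), ((j : ℕ) < p → act j = ι) ∧ (¬ (j : ℕ) < p →
        act j = ι.comp (RingOfIntegers.mapRingHom (IsCMField.complexConj K).toRingEquiv.toRingHom))) ∧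
      IsOfCMType (⨁ fun _ : Fin (2 * p) => B) ∧
      IsWeilTypeCM (⨁ fun _ : Fin (2 * p) => B) (diagHom K (fun _ => B) act b₀) R e₀ p ∧
      IsPolarizationClass (⨁ fun _ : Fin (2 * p) => B).dim (⨁ fun _ : Fin (2 * p) => B).X h ∧
      RosatiCompatible (⨁ fun _ : Fin (2 * p) => B) (diagHom K (fun _ => B) act b₀) h ∧
      HasWeilDiscriminantCM (⨁ fun _ : Fin (2 * p) => B) (diagHom K (fun _ => B) act b₀) R e₀ p h δ := by
  have hbar : ∀ φ : K →+* ℂ, φ ∈ (CMTypeOps.bar Ψ).1 ↔ ComplexEmbedding.conjugate φ ∈ Ψ.1 := fun φ =>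
    (CMTypeOps.mem_bar_iff Ψ φ).trans (CMTypeOps.conjugate_mem_iff_notMem Ψ φ).symm
  have hB' := hB.comp_complexConj hbar
  let ιc : 𝓞 K →+* End B := ι.comp (RingOfIntegers.mapRingHom (IsCMField.complexConj K).toRingEquiv.toRingHom)
  let θc : K →+* Module.End ℂ (complexBetti B.X 1) := θ.comp (IsCMField.complexConj K).toRingEquiv.toRingHom
  let act : Fin (2 * p) → (𝓞 K →+* End B) := fun j => if (j : ℕ) < p then ι else ιc
  let θB : Fin (2 * p) → (K →+* Module.End ℂ (complexBetti B.X 1)) := fun j => if (j : ℕ) < p then θ else θc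
  let Φ : Fin (2 * p) → CMType K := fun j => if (j : ℕ) < p then Ψ else CMTypeOps.bar Ψ
  have hreal : ∀ j, IsCMTypeRealisation (Φ j) B (act j) (θB j) := by
    intro j
    by_cases hj : (j : ℕ) < p
    · simp only [Φ, act, θB, if_pos hj]; exact hB
    · simp only [Φ, act, θB, if_neg hj]; exact hB'
  have hmem : ∀ (s : K →+* ℂ) (j : Fin (2 * p)), s ∈ (Φ j).1 ↔ ((j : ℕ) < p ↔ s ∈ Ψ.1) := by
    intro s j
    by_cases hj : (j : ℕ) < p
    · simp only [Φ, if_pos hj]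
      exact ⟨fun h => ⟨fun _ => h, fun _ => hj⟩, fun h => h.1 hj⟩
    · simp only [Φ, if_neg hj]
      rw [CMTypeOps.mem_bar_iff]
      exact ⟨fun h => ⟨fun h' => absurd h' hj, fun h' => absurd h' h⟩, fun h h' => hj (h.2 h')⟩
  have hadm : ∀ s : K →+* ℂ, (Finset.univ.filter fun j : Fin (2 * p) => s ∈ (Φ j).1).card = p := by
    intro s
    by_cases hs : s ∈ Ψ.1
    · have hfilt : (Finset.univ.filter fun j : Fin (2 * p) => s ∈ (Φ j).1) =
          Finset.univ.filter fun j : Fin (2 * p) => (j : ℕ) < p := by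
        refine Finset.filter_congr fun j _ => ?_
        rw [hmem]
        exact ⟨fun h => h.2 hs, fun h => ⟨fun _ => hs, fun _ => h⟩⟩
      rw [hfilt, card_filter_val_lt_two_mul']
    · have hfilt : (Finset.univ.filter fun j : Fin (2 * p) => s ∈ (Φ j).1) =
          Finset.univ.filter fun j : Fin (2 * p) => ¬ (j : ℕ) < p := by
        refine Finset.filter_congr fun j _ => ?_
        rw [hmem]
        exact ⟨fun h hj => hs (h.1 hj), fun h => ⟨fun hj => absurd hj h, fun h' => absurd h' hs⟩⟩
      rw [hfilt, card_filter_not_val_lt_two_mul']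
  obtain ⟨hW, h, hpol, hros, hdisc⟩ :=
    exists_polarizationClass_hasWeilDiscriminantCM_of_constantSum' K hK rfl hp (fun _ => B) act hreal hadm hb₀ hsep
      he hRm hRdeg hR hirr hroots haev hdegQ δ
  refine ⟨act, h, fun j => ⟨fun hj => if_pos hj, fun hj => if_neg hj⟩, ?_, hW, hpol, hros, hdisc⟩
  exact CMCodimTwo.isOfCMType_biproduct_fin (fun _ => B) fun _ => hB.isOfCMType

open scoped Classical in
/-- **The census member `B^p × (B^ρ)^p` on EVERY δ-row — ANY CM field** (Deligne's presentation `(b₀, R)`, no Galois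
hypothesis; one realisation `B`; every `p ≥ 1`, EVERY `δ`): the power is of CM type, of dimension `2p·e₀`, with a
Weil-type `η` and a Rosati-compatible polarization class of discriminant `δ`. [cite: Deligne1982HodgeCycles, §5 (b)–(c) pp. 38–39] -/
theorem exists_cmPower_hasWeilDiscriminantCM_anyCM (hK : 2 < Module.finrank ℚ K)
    {b₀ : 𝓞 K} (hb₀ : IsCMField.complexConj K (b₀ : K) = -(b₀ : K))
    (hsep : Function.Injective fun σ : K →+* ℂ => σ (b₀ : K))
    {R : Polynomial ℤ} {e₀ : ℕ} (he : Module.finrank ℚ K = 2 * e₀) (hRm : R.Monic) (hRdeg : R.natDegree = e₀)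
    (hR : R.comp (X ^ 2) = minpoly ℤ b₀) (hirr : Irreducible (cmPolyQ R))
    (hroots : ∀ s : ℂ, Polynomial.eval₂ (Int.castRingHom ℂ) s R = 0 → s.im = 0 ∧ s.re < 0)
    (haev : Polynomial.aeval (b₀ : K) (cmPolyQ R) = 0) (hdegQ : (cmPolyQ R).natDegree = Module.finrank ℚ K)
    [Fact (Irreducible (realPolyQ R))]
    {Ψ : CMType K} {B : AbelianVariety ℂ} {ι : 𝓞 K →+* End B} {θ : K →+* Module.End ℂ (complexBetti B.X 1)}
    (hB : IsCMTypeRealisation Ψ B ι θ) {p : ℕ} (hp : 0 < p) (δ : cmNormResidueGroup R) :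
    ∃ (act : Fin (2 * p) → (𝓞 K →+* End B)) (h : complexBetti (⨁ fun _ : Fin (2 * p) => B).X 2),
      (∀ j : Fin (2 * p), ((j : ℕ) < p → act j = ι) ∧ (¬ (j : ℕ) < p →
        act j = ι.comp (RingOfIntegers.mapRingHom (IsCMField.complexConj K).toRingEquiv.toRingHom))) ∧
      (⨁ fun _ : Fin (2 * p) => B).dim = 2 * p * e₀ ∧ IsOfCMType (⨁ fun _ : Fin (2 * p) => B) ∧
      IsWeilTypeCM (⨁ fun _ : Fin (2 * p) => B) (diagHom K (fun _ => B) act b₀) R e₀ p ∧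
      IsPolarizationClass (⨁ fun _ : Fin (2 * p) => B).dim (⨁ fun _ : Fin (2 * p) => B).X h ∧
      RosatiCompatible (⨁ fun _ : Fin (2 * p) => B) (diagHom K (fun _ => B) act b₀) h ∧
      HasWeilDiscriminantCM (⨁ fun _ : Fin (2 * p) => B) (diagHom K (fun _ => B) act b₀) R e₀ p h δ := by
  obtain ⟨act, h, hact, hcm, hW, hpol, hros, hdisc⟩ :=
    exists_cmPower_hasWeilDiscriminantCM' K hK hb₀ hsep he hRm hRdeg hR hirr hroots haev hdegQ hB hp δ
  exact ⟨act, h, hact, hW.dim_eq, hcm, hW, hpol, hros, hdisc⟩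

/-- **Any CM field with a NONDEGENERATE type: HC at the CM power member of every δ-cell** (Galois-free form of
part X-C). [cite: Pohlmann1968, Thm. 1] [cite: Deligne1982HodgeCycles, §5 (c) pp. 38–39] -/
theorem exists_cmMember_hodgeConjectureFor_of_exists_isNondegenerate (hK : 2 < Module.finrank ℚ K)
    {b₀ : 𝓞 K} (hb₀ : IsCMField.complexConj K (b₀ : K) = -(b₀ : K))
    (hsep : Function.Injective fun σ : K →+* ℂ => σ (b₀ : K))
    {R : Polynomial ℤ} {e₀ : ℕ} (he : Module.finrank ℚ K = 2 * e₀) (hRm : R.Monic) (hRdeg : R.natDegree = e₀)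
    (hR : R.comp (X ^ 2) = minpoly ℤ b₀) (hirr : Irreducible (cmPolyQ R))
    (hroots : ∀ s : ℂ, Polynomial.eval₂ (Int.castRingHom ℂ) s R = 0 → s.im = 0 ∧ s.re < 0)
    (haev : Polynomial.aeval (b₀ : K) (cmPolyQ R) = 0) (hdegQ : (cmPolyQ R).natDegree = Module.finrank ℚ K)
    [Fact (Irreducible (realPolyQ R))] (hnd : ∃ Ψ : CMType K, IsNondegenerate Ψ) {p : ℕ} (hp : 0 < p)
    (δ : cmNormResidueGroup R) :
    ∃ (A : AbelianVariety ℂ) (η : A ⟶ A) (h : complexBetti A.X 2),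
      IsOfCMType A ∧ IsWeilTypeCM A η R e₀ p ∧ IsPolarizationClass A.dim A.X h ∧ RosatiCompatible A η h ∧
      HasWeilDiscriminantCM A η R e₀ p h δ ∧ HodgeConjectureFor A.dim A.X ∧
      weilClassesField A η (R.comp (X ^ 2)) (2 * p) ≤ algebraicClasses A.X p := by
  obtain ⟨Ψ, hΨ⟩ := hnd
  obtain ⟨B, ι, θ, hB⟩ := exists_isCMTypeRealisation Ψ
  obtain ⟨act, h, -, hcm, hW, hpol, hros, hdisc⟩ :=
    exists_cmPower_hasWeilDiscriminantCM' K hK hb₀ hsep he hRm hRdeg hR hirr hroots haev hdegQ hB hp δ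
  have hHC : HodgeConjectureFor (⨁ fun _ : Fin (2 * p) => B).dim (⨁ fun _ : Fin (2 * p) => B).X :=
    hΨ.hodgeConjectureFor_pow hB (2 * p)
  exact ⟨_, _, h, hcm, hW, hpol, hros, hdisc, hHC, hW.weilClassesField_le_algebraicClasses_of_hodgeConjectureFor hHC⟩

/-- **Every NON-GALOIS QUARTIC CM field (the census's `D₄` field `ℚ(√-(3+√2))`): HC at a CM eightfold on EVERY row
`W8.E.δ`** — primitive type (Schappacher) ⇒ nondegenerate (Yanai) ⇒ `Hdg = Div` on `B⁴` (Pohlmann); a Weil-type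
`(2,2;2,2)` datum, a Rosati-compatible polarization class of discriminant `δ`, HC for `B⁴` and `W_E(B⁴) ⊗ ℂ` algebraic.
[cite: Schmidt1984CMArithmetik, Kap. II Satz 1.6] [cite: Yanai1985, §4 Theorem] [cite: Pohlmann1968, Thm. 1] -/
theorem exists_cmEightfold_hodgeConjectureFor_of_not_isGalois_four (hG : ¬ IsGalois ℚ K)
    (h4 : Module.finrank ℚ K = 4)
    {b₀ : 𝓞 K} (hb₀ : IsCMField.complexConj K (b₀ : K) = -(b₀ : K))
    (hsep : Function.Injective fun σ : K →+* ℂ => σ (b₀ : K))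
    {R : Polynomial ℤ} {e₀ : ℕ} (he : Module.finrank ℚ K = 2 * e₀) (hRm : R.Monic) (hRdeg : R.natDegree = e₀)
    (hR : R.comp (X ^ 2) = minpoly ℤ b₀) (hirr : Irreducible (cmPolyQ R))
    (hroots : ∀ s : ℂ, Polynomial.eval₂ (Int.castRingHom ℂ) s R = 0 → s.im = 0 ∧ s.re < 0)
    (haev : Polynomial.aeval (b₀ : K) (cmPolyQ R) = 0) (hdegQ : (cmPolyQ R).natDegree = Module.finrank ℚ K)
    [Fact (Irreducible (realPolyQ R))] (δ : cmNormResidueGroup R) :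
    ∃ (A : AbelianVariety ℂ) (η : A ⟶ A) (h : complexBetti A.X 2),
      A.dim = 8 ∧ IsOfCMType A ∧ IsWeilTypeCM A η R 2 2 ∧ IsPolarizationClass A.dim A.X h ∧ RosatiCompatible A η h ∧
      HasWeilDiscriminantCM A η R 2 2 h δ ∧ HodgeConjectureFor A.dim A.X ∧
      weilClassesField A η (R.comp (X ^ 2)) (2 * 2) ≤ algebraicClasses A.X 2 := by
  have he₀ : e₀ = 2 := by omega
  subst he₀
  obtain ⟨Θ, hΘ⟩ := PrimitiveCMTypeNonGalois.exists_isPrimitive_of_not_isGalois (K := K) hG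
  obtain ⟨φ₀⟩ : Nonempty (K →+* ℂ) := inferInstance
  have hnd : IsNondegenerate Θ := isNondegenerate_of_isPrimitive_of_prime Nat.prime_two h4 φ₀ (hΘ φ₀)
  obtain ⟨A, η, h, hcm, hW, hpol, hros, hdisc, hHC, halg⟩ :=
    exists_cmMember_hodgeConjectureFor_of_exists_isNondegenerate K (by omega) hb₀ hsep he hRm hRdeg hR hirr hroots haev
      hdegQ ⟨Θ, hnd⟩ two_pos δ
  exact ⟨A, η, h, by rw [hW.dim_eq]; rfl, hcm, hW, hpol, hros, hdisc, hHC, halg⟩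

end AnyCM

end Summit.HodgeConjecture.HodgeConjecture.Ring2.WeilCoverageCM

end
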